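import Summits.BirchSwinnertonDyer.BirchSwinnertonDyer.Theorems.Rank1ResidualJetSwapPrime
import Summits.BirchSwinnertonDyer.BirchSwinnertonDyer.Theorems.KatoDescentTamePotSupersingularJetchevIrreducibleSwapPlumbing
import Summits.BirchSwinnertonDyer.BirchSwinnertonDyer.Theorems.KatoDescentTamePotSupersingularJetchevIrreducibleCoreVertexCebotarevShift
import Summits.BirchSwinnertonDyer.BirchSwinnertonDyer.Theorems.KatoDescentTamePotSupersingularJetchevIrreducibleReadingThm52Bricks
import Summits.BirchSwinnertonDyer.BirchSwinnertonDyer.Theorems.ErratumRoadFiveNonSurjCornerKolyJWalkOrders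
import Summits.BirchSwinnertonDyer.BirchSwinnertonDyer.Theorems.KatoDescentTamePotSupersingularJetchevIrreducibleReadingSignUnconditional
import HarnessLib

/-!
# Crux `JetchevIrreducibleReadingByName` (item 20165, shared K8-t′ / K9, cell `bsd-potss`), registered stub S2′
# `stub_prop52IrredP` (McCallum 1991 Prop. 5.2 in the IRREDUCIBLE reading): Kolyvagin's PRIME SWAP `n ↦ n·ℓ'/ℓ₀` at
# minimal depth, the `λ'` half — cell `bsd-jet`'s `JET.Swap.exists_swapPrime` PORTED to `E[p]` irreducible + `p ∣ N_E`

Seat `bsd-potss-k8t-c4` g12 (prover), `--supports stmt-BirchSwinnertonDyer-20165`, helper; route-free. HONEST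
FRAMING: helper theorems only; nothing is booked, no item closes, BSD is proved for no curve by any of this.

WHAT. Cell `bsd-jet` (seat pv-2 g6, `Rank1ResidualJetSwapPrime`, p545934) proved the `λ'` half of McCallum's prime
swap (LMS LN 153, proof of Prop. 5.2, pp. 305–306, run at level `p` on the ROOT class `c₁(P_n ∕ p^u)` — the printed
level-`p` auxiliary class pairs correctly only against the divided class) in the SURJECTIVE frame `ρ̄_{E,p}` onto.
The shared K8-t′/K9 stub S2′ needs the same statement on the rows `E[p]` IRREDUCIBLE, `p ∣ N_E`. In pv-2's proof the
image enters through exactly five tree theorems, each of which now has an irreducible twin: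
* the root class `κ̃ = c₁(P_n ∕ p^u)` (stepL `Koly.exists_tildeClass_of_exactDepth_of_surj`) ↦ stepL corner-p1's
  `Koly.exists_tildeClass_of_exactDepth_of_irreducible` (`…CornerKolyJWalkOrders`; admissibility from `NoTorsionIrr`);
* `ι_* c₁(Q) = c_{1+u}(P_n)` (`Walk.torsionH1OfDvd_rootClass`) ↦ `torsionH1OfDvd_rootClass_of_admissible` (`…SwapPlumbing` §0;
  = k9-c4 g10's `JetchevIrreducibleCoreVertex.…`);
* the sign of `c_{1+u}(P_n)` (`JET.sign_conjAct_kolyvaginClass`) ↦ k9-c4 g9's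
  `JetchevIrreducibleReadingSign.sign_conjAct_kolyvaginClass_of_irreducible`;
* `ι_*` injective (`torsionH1OfDvd_pow_injective`, Gross Lemma 4.3) ↦ `torsionH1OfDvd_pow_injective_of_irreducible`
  (this file: `E(K)[p] = 0` for `K` quadratic and `E[p]` irreducible, Literature
  `torsionBy_eq_bot_of_isImaginaryQuadratic_of_hasIrreducibleModPGaloisRep`);
* the decoupled Čebotarev prime (`Koly.exists_kolyvaginPrime_addOrderOf_localization_eq_shift`) ↦ k9-c4 g10's
  `JetchevIrreducibleCoreVertex.exists_kolyvaginPrime_addOrderOf_localization_eq_shift_of_irreducible_of_heegner`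
  (over k8t-c4 g9's `cor32_localOrder_of_irreducible_of_heegner`).
`exists_swapPrime_of_irreducible` is pv-2's theorem and proof VERBATIM with these five calls swapped and the binder
`hρ` replaced by {`¬CM` (literal, for the Čebotarev theorem), `W.HasIrreducibleModPGaloisRep p`, `p ∣ N_E`};
all other inputs (level-`p` Poitou–Tate package and Weil datum, transverse family `𝒯` with `h𝒯σ`/`h𝒯sd`/`hloc`,
data at the divisors of `n` with `p^u ∥ P_n`) are unchanged and image-free.

References (locators only; no cited FACT is declared): [cite: McCallumLMS1991, §5 Prop. 5.2 and proof (pp. 304–306),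
Lemma 5.3, §3 Cor. 3.2] [cite: Jetchev2008, §3.1 item 7, Lemma 5.1, Lemma 5.2 (iii), Rem. 6.2] [cite: GrossLMS1991,
Prop. 5.3, Prop. 5.4, Prop. 9.6, §4 Lemma 4.3] [cite: Howard2004HeegnerKolyvagin, Thm. 2.1.11]. Design: theorems only;
`K : Type`. Axioms: `propext`, `Classical.choice`, `Quot.sound`.
-/

set_option autoImplicit false
-- the Theorems directory repeats the summit name (sibling precedent `KatoDescentPotSupersingularAssembly.lean`)
set_option linter.dupNamespace false

noncomputable section

open scoped Classical Pointwise
open Function NumberField IsDedekindDomain WeierstrassCurve Field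
open Literature.NumberTheory.EllipticCurves Literature.NumberTheory.GaloisRepresentations
open Literature.NumberTheory.EllipticCurves.Jetchev2008 Literature.NumberTheory.EllipticCurves.KolyvaginCocycle
open Literature.NumberTheory.EllipticCurves.ModularForms
open Literature.NumberTheory.GaloisCohomology Literature.NumberTheory.Automorphic
open Literature.NumberTheory.GaloisRepresentations.DiscreteGaloisModule (transverseSubgroup SelmerStructure)
open Summit.BirchSwinnertonDyer.Rank1Residual
open Summit.BirchSwinnertonDyer.Rank1Residual.JET
open Summit.BirchSwinnertonDyer.Rank1Residual.JET.SelmerVocabulary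
open Summit.BirchSwinnertonDyer.Rank1Residual.JET.GlobalDuality
open Summit.BirchSwinnertonDyer.Rank1Residual.X11b
open Summit.BirchSwinnertonDyer.Rank1Residual.X11b.Three
open Summit.BirchSwinnertonDyer.BirchSwinnertonDyer.Theorems
open Summit.BirchSwinnertonDyer.Rank1Residual.X11b.Three.Koly (exists_tildeClass_of_exactDepth_of_irreducible)

namespace Summit.BirchSwinnertonDyer.BirchSwinnertonDyer.Theorems.JetchevIrreducibleSwap

variable {K : Type} [Field K] [NumberField K] (W : WeierstrassCurve ℚ) [W.IsElliptic]
  [W.IsGloballyMinimal] [NeZero (W.conductorNorm ℤ)]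

/-! ### §1 `ι_* : H¹(K, E[p^M]) → H¹(K, E[p^{M+k}])` is injective on an irreducible row (`E(K)[p] = 0`) -/

omit [W.IsGloballyMinimal] [NeZero (W.conductorNorm ℤ)] in
/-- **No `Γ_K`-fixed `p`-power torsion** for `K` imaginary quadratic and `E[p]` IRREDUCIBLE (`E(K)[p] = 0`, Literature
`torsionBy_eq_bot_of_isImaginaryQuadratic_of_hasIrreducibleModPGaloisRep`, image-free): a `Γ_K`-fixed point of
`E(K̄)[p^j]` is `0`. = stepL shim-p1's `geomTorsion_pow_eq_zero_of_fixed` with the surjectivity binder replaced.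
[cite: GrossLMS1991, §2 (after (2.2)), §4 Lemma 4.3] -/
theorem geomTorsion_pow_eq_zero_of_fixed_of_irreducible (hK : IsImaginaryQuadratic K) {p : ℕ} (hp : p.Prime)
    (hirr : W.HasIrreducibleModPGaloisRep p) (j : ℕ)
    (P : geomTorsion (W.baseChange K) ((p ^ j : ℕ) : ℤ))
    (hP : ∀ σ : absoluteGaloisGroup K, σ • P = P) : P = 0 := by
  haveI : (W.baseChange K).IsElliptic := inferInstanceAs (W.map (algebraMap ℚ K)).IsElliptic
  haveI : PerfectField K := PerfectField.ofCharZero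
  have hbot := torsionBy_eq_bot_of_isImaginaryQuadratic_of_hasIrreducibleModPGaloisRep W K hK hp hirr
  have hA : ∀ a : (W.baseChange K).toAffine.Point, p • a = 0 → a = 0 := fun a ha ↦ by
    have : a ∈ AddSubgroup.torsionBy (W.baseChange K).toAffine.Point (p : ℤ) := by
      rw [mem_torsionBy_iff, natCast_zsmul]; exact ha
    rw [hbot] at this
    exact this
  have hpow : ∀ (j : ℕ) (R : (W.baseChange K).toAffine.Point), p ^ j • R = 0 → R = 0 := by
    intro j
    induction j with
    | zero => intro R h; simpa using h
    | succ j ih =>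
      intro R h
      exact ih R (hA _ (by rw [← mul_nsmul, ← pow_succ]; exact h))
  have hfix : ∀ σ : absoluteGaloisGroup K, σ • (P : geomPoints (W.baseChange K)) = P :=
    fun σ ↦ congrArg Subtype.val (hP σ)
  obtain ⟨R, hR⟩ := exists_toGeomPoints_eq_of_forall_smul_eq (W.baseChange K) hfix
  have hRj : p ^ j • R = 0 := by
    apply toGeomPoints_injective (W.baseChange K)
    rw [map_nsmul, hR, map_zero, ← natCast_zsmul]
    push_cast
    exact (mem_geomTorsion_iff _ _ _).mp P.2
  apply Subtype.ext
  rw [ZeroMemClass.coe_zero, ← hR, hpow j R hRj, map_zero]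

omit [W.IsGloballyMinimal] [NeZero (W.conductorNorm ℤ)] in
/-- **`ι_* : H¹(K, E[p^M]) → H¹(K, E[p^{M+k}])` is injective** for `K` imaginary quadratic and `E[p]` IRREDUCIBLE:
the kernel is `E[p^{M+k}]^{Γ_K}/p^M` (Kummer) and `E[p^{M+k}]^{Γ_K} = 0`. = shim-p1's `torsionH1OfDvd_pow_injective`
with the surjectivity binder replaced. [cite: GreenbergLNM1716, §2 p. 63] [cite: McCallumLMS1991, §4 (5), Lemma 4.6] -/
theorem torsionH1OfDvd_pow_injective_of_irreducible (hK : IsImaginaryQuadratic K) {p : ℕ} (hp : p.Prime)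
    (hirr : W.HasIrreducibleModPGaloisRep p) (M k : ℕ) :
    Function.Injective
      (torsionH1OfDvd (W.baseChange K) (natCast_pow_dvd_natCast_pow_add p M k)) := by
  haveI : (W.baseChange K).IsElliptic := inferInstanceAs (W.map (algebraMap ℚ K)).IsElliptic
  have key : Function.Injective
      (galoisCohomology.map ((W.baseChange K).torsionInclusion
        (natCast_pow_dvd_natCast_pow_add p M k)) 1) := by
    refine X11b.Levels.map_one_injective_of_forall_fixed_eq_zero (n := p ^ M) ?_ ?_ ?_ ?_
    · intro b hb
      have hb' : ((p ^ M : ℕ) : ℤ) • (b : geomPoints (W.baseChange K)) = 0 := by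
        rw [natCast_zsmul, ← AddSubmonoidClass.coe_nsmul, hb, ZeroMemClass.coe_zero]
      exact ⟨⟨(b : geomPoints (W.baseChange K)), (mem_geomTorsion_iff _ _ _).2 hb'⟩,
        Subtype.ext rfl⟩
    · intro a a' h
      exact Subtype.ext (congrArg
        (fun P : geomTorsion (W.baseChange K) ((p ^ (M + k) : ℕ) : ℤ) ↦
          (P : geomPoints (W.baseChange K))) h)
    · intro a
      apply Subtype.ext
      rw [AddSubmonoidClass.coe_nsmul, ZeroMemClass.coe_zero, ← natCast_zsmul]
      exact (mem_geomTorsion_iff _ _ _).1 a.2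
    · intro b hb
      exact geomTorsion_pow_eq_zero_of_fixed_of_irreducible W hK hp hirr (M + k) b fun σ ↦ by
        have h := hb σ
        rwa [torsionGaloisModule_apply_apply] at h
  intro x y hxy
  apply key
  rw [map_torsionInclusion_one_apply, map_torsionInclusion_one_apply]
  exact hxy

/-! ### §2 The `λ'` half of Kolyvagin's swap on an irreducible row -/

section Prime

variable (τ : K ≃ₐ[ℚ] K) (p : ℕ) [Fact p.Prime] [NeZero (p ^ 1)]
  [Finite (geomTorsion (W.baseChange K) ((p ^ 1 : ℕ) : ℤ))]
  (e : geomTorsion (W.baseChange K) ((p ^ 1 : ℕ) : ℤ) → geomTorsion (W.baseChange K) ((p ^ 1 : ℕ) : ℤ) →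
    AlgebraicClosure K)
  (hμ : ∀ S T, e S T ^ (p ^ 1) = 1)
  (hadd₁ : ∀ S₁ S₂ T, e (S₁ + S₂) T = e S₁ T * e S₂ T)
  (hadd₂ : ∀ S T₁ T₂, e S (T₁ + T₂) = e S T₁ * e S T₂)
  (hgal : ∀ (g : absoluteGaloisGroup K) (S T : geomTorsion (W.baseChange K) ((p ^ 1 : ℕ) : ℤ)),
    g • e S T = e (g • S) (g • T))
  (halt : ∀ T, e T T = 1) (hnondeg : ∀ T, (∀ S, e S T = 1) → T = 0)
  (hτe : ∀ S T, liftAut τ (e S T) =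
    e ((isLiftOfAut_liftAut τ).torsionMap W ((p ^ 1 : ℕ) : ℤ) S)
      ((isLiftOfAut_liftAut τ).torsionMap W ((p ^ 1 : ℕ) : ℤ) T))

include halt hnondeg hτe in
/-- **The `λ'` half of Kolyvagin's swap — IRREDUCIBLE row** (McCallum, proof of Prop. 5.2, pp. 305–306, with Lemma 5.3
and Cor. 3.2; run at level `p` on the root class). Data: the frame (`K` imaginary quadratic, `d_K ∉ {−3,−4}`, Heegner
for `N_E`, `¬CM`, `p` odd with `E[p]` IRREDUCIBLE and `p ∣ N_E`, `τ ≠ 1`, `τ² = 1`), the level-`p` Poitou–Tate package and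
Weil datum, a transverse family `𝒯` at level `p` (`τ`-stable, self-dual at the places over Kolyvagin primes) with the
local index `hloc`, a square-free conductor `n` of Kolyvagin primes of index `≥ 1 + u` with data at its divisors whose
derived point `P_n` has EXACT depth `u`, a prime `ℓ₀ ∣ n`, and bounds `j ≥ u`, `b`. CONCLUSION: a Kolyvagin prime
`ℓ' > b` of index `≥ 1 + j`, `ℓ' ∤ n`, with places `λ' ∋ ℓ'`, `λ₀ ∋ ℓ₀`, a class `t ∈ (H¹_{𝓕(n/ℓ₀)^{λ₀}})^{−e₀}`
(`e₀ = −w(E)·(−1)^{#primes of n}`) with `loc_{λ'} t ≠ 0`, and `loc_{λ'} c_{1+u}(P_n) ≠ 0`. = `JET.Swap.exists_swapPrime`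
with the five image-dependent calls swapped (module docstring). [cite: McCallumLMS1991, §5 proof of Prop. 5.2 (pp. 305–306), Lemma 5.3]
[cite: Jetchev2008, Lemma 5.1, Lemma 5.2 (iii), Rem. 6.2] -/
theorem exists_swapPrime_of_irreducible (hK : IsImaginaryQuadratic K)
    (hD3 : NumberField.discr K ≠ -3) (hD4 : NumberField.discr K ≠ -4)
    (hH : SatisfiesHeegnerHypothesis (W.conductorNorm ℤ) K) (hcm : ¬ W.HasCM) (hp2 : p ≠ 2)
    (hirr : W.HasIrreducibleModPGaloisRep p) (hpN : p ∣ W.conductorNorm ℤ)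
    (hτ1 : τ ≠ 1) (hττ : τ * τ = 1)
    (Dt : ModularParametrizationData W (W.conductorNorm ℤ)) (β : ℤ) (ι : K →+* ℂ)
    (inv : LocalInvariants K (p ^ 1)) (hperf : inv.IsPerfect) (hvan : inv.SumLocalTermEqZero)
    (hSC : inv.SelmerComplement) (hinv : inv.IsConjCompatible τ)
    (𝒯 : SelmerStructure ((W.baseChange K).torsionGaloisModule ((p ^ 1 : ℕ) : ℤ)))
    (h𝒯σ : ∀ (c : ℕ), Squarefree c →
      (∀ q ∈ c.primeFactors, Zhang2014.IsKolyvaginPrime (W.conductorNorm ℤ) W K p q) →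
      ∀ (v w : HeightOneSpectrum (𝓞 K)) (h : τ • v = w), v ∈ placesDividing K c →
      ∀ x : galoisCohomology (((W.baseChange K).torsionGaloisModule ((p ^ 1 : ℕ) : ℤ)).toLocal
        (Sum.inr v : Place K)) 1,
      x ∈ 𝒯 (Sum.inr v) → conjActPlace W τ ((p ^ 1 : ℕ) : ℤ) h x ∈ 𝒯 (Sum.inr w))
    (h𝒯sd : ∀ (c : ℕ), Squarefree c →
      (∀ q ∈ c.primeFactors, Zhang2014.IsKolyvaginPrime (W.conductorNorm ℤ) W K p q) →
      ∀ v ∈ placesDividing K c,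
      inv.dualTransported 𝒯 (weilDualIntertwining (W.baseChange K) (p ^ 1) e hμ hadd₁ hadd₂ hgal)
        (Sum.inr v) = 𝒯 (Sum.inr v))
    (hloc : ∀ ℓ : ℕ, Zhang2014.IsKolyvaginPrime (W.conductorNorm ℤ) W K p ℓ →
      1 ≤ Zhang2014.kolyvaginIndex W p ℓ →
      ∀ (v : HeightOneSpectrum (𝓞 K)), (ℓ : 𝓞 K) ∈ v.asIdeal → ∀ (hfix : τ • v = v) (s : ℤ),
      (s = 1 ∨ s = -1) →
      ((W.baseChange K).kummerSelmerStructure ((p ^ 1 : ℕ) : ℤ) (Sum.inr v)).relIndex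
        ((conjActPlace W τ ((p ^ 1 : ℕ) : ℤ) hfix - s • AddMonoidHom.id _).ker) = p ^ 1)
    {u j : ℕ} (hju : u ≤ j) (b : ℕ) {n l₀ : ℕ} (hn : Squarefree n)
    (hnK : ∀ q ∈ n.primeFactors, Zhang2014.IsKolyvaginPrime (W.conductorNorm ℤ) W K p q ∧
      1 + u ≤ Zhang2014.kolyvaginIndex W p q)
    (hl₀ : l₀ ∈ n.primeFactors)
    (data : (m : ℕ) → m ∣ n → KolyvaginHeegnerData Dt β ι m)
    (hdvd : ∃ Q : (W.baseChange (ringClassField K ι n)).toAffine.Point,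
      ((p ^ u : ℕ) : ℤ) • Q = (data n dvd_rfl).derivedPoint)
    (hndvd : ¬ ∃ Q : (W.baseChange (ringClassField K ι n)).toAffine.Point,
      ((p ^ (u + 1) : ℕ) : ℤ) • Q = (data n dvd_rfl).derivedPoint) :
    ∃ (ℓ' : ℕ) (v' v₀ : HeightOneSpectrum (𝓞 K))
      (t : galoisCohomology ((W.baseChange K).torsionGaloisModule ((p ^ 1 : ℕ) : ℤ)) 1),
      b < ℓ' ∧ Zhang2014.IsKolyvaginPrime (W.conductorNorm ℤ) W K p ℓ' ∧
      1 + j ≤ Zhang2014.kolyvaginIndex W p ℓ' ∧ ℓ' ∉ n.primeFactors ∧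
      (ℓ' : 𝓞 K) ∈ v'.asIdeal ∧ (l₀ : 𝓞 K) ∈ v₀.asIdeal ∧
      t ∈ signPart W K τ ((p ^ 1 : ℕ) : ℤ) (-(-W.rootNumber * (-1) ^ n.primeFactors.card))
        (((selmerF W ((p ^ 1 : ℕ) : ℤ) 𝒯 (placesDividing K (n / l₀))).relaxedAt {v₀}).selmerGroup) ∧
      galoisCohomology.localization ((W.baseChange K).torsionGaloisModule ((p ^ 1 : ℕ) : ℤ))
        (Sum.inr v' : Place K) 1 t ≠ 0 ∧
      galoisCohomology.localization ((W.baseChange K).torsionGaloisModule ((p ^ (1 + u) : ℕ) : ℤ))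
        (Sum.inr v' : Place K) 1 ((data n dvd_rfl).kolyvaginClass (Fact.out : p.Prime) (1 + u)) ≠ 0 := by
  have hp : p.Prime := Fact.out
  have hND : IsCoprime ((W.conductorNorm ℤ : ℕ) : ℤ) (NumberField.discr K) :=
    KolyvaginAssembly.isCoprime_discr_of_satisfiesHeegnerHypothesis hK hH
  have hD : NumberField.discr K < -4 := KolyvaginAssembly.discr_lt_neg_four hK ⟨hD3, hD4⟩
  -- the irreducible frame: `p` splits in `K` (Heegner + `p ∣ N_E`), hence is unramified; `p ∤ n`
  have hHp : SatisfiesHeegnerHypothesis p K := hH.of_dvd hpN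
  have hKunr := X11b.isUnramifiedIn_of_satisfiesHeegnerHypothesis_of_dvd hK hH hp hpN
  have hn0 : n ≠ 0 := hn.ne_zero
  have hpn : ¬ p ∣ n := JetchevIrreducibleReadingThm52Bricks.not_dvd_of_primeFactors_isKolyvaginPrime hp hn0 hnK
  have hl₀p : l₀.Prime := Nat.prime_of_mem_primeFactors hl₀
  have hl₀n : l₀ ∣ n := Nat.dvd_of_mem_primeFactors hl₀
  have hKol₀ : Zhang2014.IsKolyvaginPrime (W.conductorNorm ℤ) W K p l₀ := (hnK l₀ hl₀).1
  -- §1 the root class `x = c₁(P_n / p^u)`: order `p`, sign `e₀`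
  obtain ⟨hA1, Q, hQ, hQP, hord, -⟩ := exists_tildeClass_of_exactDepth_of_irreducible (Dt := Dt) (β := β)
    (ι := ι) hK hND hD hp hp2 hirr hHp (k := 1) (u := u) le_rfl hn hnK data hdvd hndvd
  set x : galH1Torsion (W.baseChange K) ((p ^ 1 : ℕ) : ℤ) :=
    kolyvaginClass (W.baseChange K) ((p ^ 1 : ℕ) : ℤ)
      ((W.baseChange K).zsmul_geomPoints_surjective_of_charZero
        (by exact_mod_cast pow_ne_zero 1 hp.ne_zero)) hA1 ((data n dvd_rfl).toGeomPoints Q) hQ with hxdef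
  have hx0 : x ≠ 0 := by
    intro h
    have : addOrderOf x = 1 := by rw [h, addOrderOf_zero]
    rw [hord, pow_one] at this
    exact hp.one_lt.ne' this
  -- the sign of `x`: transported DOWN from the unconditional sign of `c_{1+u}(P_n)` along `ι_*`
  have hP : (data n dvd_rfl).toGeomPoints (data n dvd_rfl).derivedPoint ∈
      invPoints (absoluteGaloisGroup K) (data n dvd_rfl).pointsSubgroup ((p ^ (1 + u) : ℕ) : ℤ) :=
    KolyCert.toGeomPoints_derivedPoint_mem_invPoints_of_dvd_zhang hK ι Dt hp hND hD hn hnK data n dvd_rfl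
  have hA : IsAdmissible (absoluteGaloisGroup K) (data n dvd_rfl).pointsSubgroup ((p ^ (1 + u) : ℕ) : ℤ) :=
    NoTorsionIrr.isAdmissible_pointsSubgroup_of_hasIrreducibleModPGaloisRep (data n dvd_rfl) hK hn0 hp hp2 hirr
      (W.exists_weilPairing_holds p) hKunr hpn (1 + u)
  have hroot := torsionH1OfDvd_rootClass_of_admissible W hp (data n dvd_rfl) 1 u Q hA1 hQ hQP hA hP
  have hdn : p ^ 1 ∣ p ^ (1 + u) := pow_dvd_pow p (Nat.le_add_right 1 u)
  obtain ⟨he₀, hκsign⟩ := JetchevIrreducibleReadingSign.sign_conjAct_kolyvaginClass_of_irreducible hK hD3 hD4 hH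
    hp2 hirr hpN τ hτ1 Dt β ι hn (k := 1 + u) (by omega) hnK (data n dvd_rfl)
  set e₀ : ℤ := -W.rootNumber * (-1) ^ n.primeFactors.card with he₀def
  have hxsign : conjAct W τ ((p ^ 1 : ℕ) : ℤ) x = e₀ • x :=
    conjAct_eq_smul_of_torsionH1OfDvd W τ _ (torsionH1OfDvd_pow_injective_of_irreducible W hK hp hirr 1 u) e₀ x
      (by rw [hroot]; exact hκsign)
  -- §2 the places `λ₀ ∋ ℓ₀`; the conductor `m = n / ℓ₀`
  obtain ⟨v₀, hv₀⟩ := Swap.exists_place_natCast_mem (K := K) hl₀p hKol₀.2.2.2.2.1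
  have hfix₀ : τ • v₀ = v₀ := smul_place_eq_self_of_natCast_mem τ hl₀p.ne_zero hKol₀.2.2.2.2.1 v₀ hv₀
  set m : ℕ := n / l₀ with hmdef
  have hmn : m ∣ n := Nat.div_dvd_of_dvd hl₀n
  have hm : Squarefree m := hn.squarefree_of_dvd hmn
  have hm0 : m ≠ 0 := hm.ne_zero
  have hmK : ∀ q ∈ m.primeFactors, Zhang2014.IsKolyvaginPrime (W.conductorNorm ℤ) W K p q :=
    fun q hq ↦ (hnK q (Nat.primeFactors_mono hmn hn0 hq)).1
  have hl₀m : l₀ ∉ m.primeFactors := by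
    intro h
    have hdvd' : l₀ * l₀ ∣ n := by
      have := Nat.mul_dvd_mul_left l₀ (Nat.dvd_of_mem_primeFactors h)
      rwa [Nat.mul_div_cancel' hl₀n] at this
    exact hl₀p.one_lt.ne' (Nat.isUnit_iff.mp (hn l₀ hdvd'))
  -- §3 the auxiliary class `t` (Jetchev Lemma 5.2 (iii) at the relaxed place `λ₀ ∤ m`)
  have hs : (-e₀ = 1 ∨ -e₀ = -1) := by rcases he₀ with h | h <;> [right; left] <;> omega
  have hcount := Walk.natCard_map_localization_signPart_relaxedAt W τ p 1 e hμ hadd₁ hadd₂ hgal halt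
    hnondeg hτe hττ hp2 le_rfl inv hperf hvan hSC hinv 𝒯 hm0 (h𝒯σ m hm hmK) (h𝒯sd m hm hmK) hs
    (fun ℓ hℓ hk _ v hv hfix ↦ hloc ℓ hℓ hk v hv hfix _ hs) l₀ hKol₀ hKol₀.2.2.2.2.2 hl₀m v₀ hv₀
  obtain ⟨t, ht, ht₀⟩ := Swap.exists_mem_map_ne_zero _ _ (by rw [hcount, pow_one]; exact hp.one_lt.ne')
  have ht0 : t ≠ 0 := fun h ↦ ht₀ (by rw [h, map_zero])
  have htsign : conjAct W τ ((p ^ 1 : ℕ) : ℤ) t = (-e₀) • t := ((mem_signPart_iff W K τ _ _ _ t).mp ht).2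
  -- §4 the decoupled Čebotarev prime `ℓ'` on the irreducible row (Heegner, `p ∣ N_E`)
  obtain ⟨ℓ', hbℓ', hKol', hjℓ', hordloc⟩ :=
    JetchevIrreducibleCoreVertex.exists_kolyvaginPrime_addOrderOf_localization_eq_shift_of_irreducible_of_heegner W
      hcm K hK hH p hp2 hirr hpN τ hτ1 (k := 1) le_rfl j he₀ x t hxsign htsign ht0 (max b n)
  have hℓ'p : ℓ'.Prime := hKol'.1
  have hbℓ : b < ℓ' := lt_of_le_of_lt (le_max_left b n) hbℓ'
  have hℓ'n : ℓ' ∉ n.primeFactors := fun h ↦ by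
    have := Nat.le_of_dvd (Nat.pos_of_ne_zero hn0) (Nat.dvd_of_mem_primeFactors h)
    exact absurd (lt_of_le_of_lt (le_max_right b n) hbℓ') (not_lt.mpr this)
  obtain ⟨v', hv'⟩ := Swap.exists_place_natCast_mem (K := K) hℓ'p hKol'.2.2.2.2.1
  obtain ⟨hxloc, htloc⟩ := hordloc v' hv'
  have htv' : galoisCohomology.localization ((W.baseChange K).torsionGaloisModule ((p ^ 1 : ℕ) : ℤ))
      (Sum.inr v' : Place K) 1 t ≠ 0 := by
    intro h
    rw [h, addOrderOf_zero] at htloc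
    exact ht0 (AddMonoid.addOrderOf_eq_one_iff.mp htloc.symm)
  have hxv' : galoisCohomology.localization ((W.baseChange K).torsionGaloisModule ((p ^ 1 : ℕ) : ℤ))
      (Sum.inr v' : Place K) 1 x ≠ 0 := by
    intro h
    rw [h, addOrderOf_zero] at hxloc
    exact hx0 (AddMonoid.addOrderOf_eq_one_iff.mp hxloc.symm)
  -- §5 transport one level up at `λ'`: `ι_* x = c_{1+u}(P_n)`, `Γ_{K_λ'}` fixes `E[p^{1+u}]`
  have h1u : 1 + u ≤ Zhang2014.kolyvaginIndex W p ℓ' := le_trans (by omega) hjℓ'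
  have htriv : ∀ (g : absoluteGaloisGroup (v'.adicCompletion K))
      (P : geomTorsion (W.baseChange K) ((p ^ (1 + u) : ℕ) : ℤ)), resGal (K := K) (v'.adicCompletion K) g • P = P :=
    Walk.resGal_adicCompletion_smul_torsion_eq_self W hK hKol' h1u v' hv'
  have hxup : galoisCohomology.localization ((W.baseChange K).torsionGaloisModule ((p ^ (1 + u) : ℕ) : ℤ))
      (Sum.inr v' : Place K) 1 ((data n dvd_rfl).kolyvaginClass hp (1 + u)) ≠ 0 := by
    rw [← hroot]
    exact fun h ↦ hxv' ((localization_eq_zero_iff_torsionH1OfDvd W hdn (pow_ne_zero 1 hp.ne_zero)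
      (pow_ne_zero _ hp.ne_zero) v' htriv x).mpr h)
  exact ⟨ℓ', v', v₀, t, hbℓ, hKol', hjℓ', hℓ'n, hv', hv₀, ht, htv', hxup⟩

end Prime

end Summit.BirchSwinnertonDyer.BirchSwinnertonDyer.Theorems.JetchevIrreducibleSwap

end
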